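import Summits.Ventures.CertifiedQuantumChemistry.Rows.ParticleTransferOperators
import HarnessLib

/-!
# Ventures/CertifiedQuantumChemistry — Rows/ParticleTransferCommutator.lean: the normal-ordered particle
# commutator operator regrouped by excitation rank, `Oᵖ = particleConst·1 + O₁ᵖ − O₂ᵖ`

HONEST FRAMING (verbatim): certified bounds for a stated model Hamiltonian in a stated basis; not a
claim about the real molecule or material beyond that model.

Typer chem-type-09 (LADDER-CHEM I-TYPE slot 09 class (s), item (L2) particle class; sequel of
`Rows/ParticleTransferOperators.lean`, prequel of `Rows/ParticleTransferRows.lean`). Pure finite-sum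
regrouping of `particleCommutatorOp_expand` + `sum_annihilation_mul_commutator_creation` against the
coefficients `c_m c_n`: the constant `particleConst = 2Σ c_m h_nm c_n`, the one-body operator
`O₁ᵖ = Σ_xy M_xy E_xy` (`M = Model.particleOneBodyRaw`) and the two-body operator `O₂ᵖ = Σ B_pqrs e_pqrs`
(`B = Model.particleTwoBodyRaw`) — the three ranks of the table `fcidump_transfer.py --class particle` writes.

## Contents (two operator `def`s; everything else PROVED)
`particleOneBodyOp`, `particleTwoBodyOp`, **`particleCommutatorOp_eq_parts`**
(`Oᵖ = particleConst·1 + O₁ᵖ − O₂ᵖ`, for the FCIDUMP symmetries `h_pq = h_qp`, `g_pqrs = g_qpsr`,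
`g_pqrs = g_rspq`, `g_pqrs = g_pqsr`). What is NOT here: the operator identity for `Ĥ(K)` and the rows
(sequel). [cite: HelgakerJorgensenOlsen2000, eq. (10.8.20)]
-/

noncomputable section

namespace Summit.Ventures.CertifiedQuantumChemistry

open Matrix Finset
open Literature.MathematicalPhysics.QuantumLattice Literature.MathematicalPhysics.QuantumChemistry
open Literature.MathematicalPhysics.QuantumLattice.EigenvalueContinuation
open scoped ComplexOrder

variable {k : ℕ}

/-- The one-body operator `O₁ᵖ = Σ_xy M_xy E_xy` of the normal-ordered particle commutator. -/
def particleOneBodyOp (c : Fin k → ℚ) (F : Model k) : Op k :=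
  ∑ x : Fin k, ∑ y : Fin k, ((Model.particleOneBodyRaw c F x y : ℚ) : ℂ) • singletExcitation x y

/-- The two-body operator `O₂ᵖ = Σ_pqrs B_pqrs e_pqrs` (`Oᵖ` contains `−O₂ᵖ`). -/
def particleTwoBodyOp (c : Fin k → ℚ) (F : Model k) : Op k :=
  ∑ p : Fin k, ∑ q : Fin k, ∑ r : Fin k, ∑ s : Fin k,
    ((Model.particleTwoBodyRaw c F p q r s : ℚ) : ℂ) • twoElectronExcitation p q r s

/-- Cyclic reordering of a triple sum: `Σ_a Σ_b Σ_c = Σ_b Σ_c Σ_a`. [folklore] -/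
private theorem sum_comm3 {α β γ : Type*} [Fintype α] [Fintype β] [Fintype γ] (f : α → β → γ → Op k) :
    ∑ a : α, ∑ b : β, ∑ c : γ, f a b c = ∑ b : β, ∑ c : γ, ∑ a : α, f a b c := by
  rw [Finset.sum_comm]
  exact Finset.sum_congr rfl fun b _ => Finset.sum_comm

/-- Regrouping of the `h`-piece: `Σ_mn c_m c_n Σ_q h_nq E_qm = Σ_xy c_y (ch)_x E_xy`. [folklore] -/
private theorem regroup_h (c : Fin k → ℚ) (F : Model k) :
    ∑ m : Fin k, ∑ n : Fin k, ((c m * c n : ℚ) : ℂ) •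
        ∑ q : Fin k, ((F.h n q : ℚ) : ℂ) • (singletExcitation q m : Op k) =
      ∑ x : Fin k, ∑ y : Fin k, ((c y * Model.holeVecH c F x : ℚ) : ℂ) • singletExcitation x y := by
  simp_rw [Finset.smul_sum, smul_smul]
  -- (m, n, q) → (q, m, n)
  rw [show (∑ m : Fin k, ∑ n : Fin k, ∑ q : Fin k,
      (((c m * c n : ℚ) : ℂ) * ((F.h n q : ℚ) : ℂ)) • (singletExcitation q m : Op k)) =
      ∑ q : Fin k, ∑ m : Fin k, ∑ n : Fin k,
        (((c m * c n : ℚ) : ℂ) * ((F.h n q : ℚ) : ℂ)) • (singletExcitation q m : Op k) from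
    (Finset.sum_congr rfl fun m _ => Finset.sum_comm).trans Finset.sum_comm]
  refine Finset.sum_congr rfl fun q _ => Finset.sum_congr rfl fun m _ => ?_
  rw [← Finset.sum_smul]
  congr 1
  rw [Model.holeVecH]
  push_cast
  rw [Finset.mul_sum]
  exact Finset.sum_congr rfl fun n _ => by ring

/-- Regrouping of the Coulomb-like piece: `Σ_mn c_m c_n (2Σ_rs g_nmrs E_sr) = Σ_xy (2Σ_mn c_m c_n g_{nmyx}) E_xy`.
[folklore] -/
private theorem regroup_g1 (c : Fin k → ℚ) (F : Model k) :
    ∑ m : Fin k, ∑ n : Fin k, ((c m * c n : ℚ) : ℂ) •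
        ((2 : ℂ) • ∑ r : Fin k, ∑ s : Fin k, ((F.eri n m r s : ℚ) : ℂ) • (singletExcitation s r : Op k)) =
      ∑ x : Fin k, ∑ y : Fin k,
        ((2 * ∑ m : Fin k, ∑ n : Fin k, c m * c n * F.eri n m y x : ℚ) : ℂ) • singletExcitation x y := by
  simp_rw [Finset.smul_sum, smul_smul]
  -- (m, n, r, s) → (s, r, m, n)
  rw [show (∑ m : Fin k, ∑ n : Fin k, ∑ r : Fin k, ∑ s : Fin k,
      (((c m * c n : ℚ) : ℂ) * (2 * ((F.eri n m r s : ℚ) : ℂ))) • (singletExcitation s r : Op k)) =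
      ∑ r : Fin k, ∑ s : Fin k, ∑ m : Fin k, ∑ n : Fin k,
        (((c m * c n : ℚ) : ℂ) * (2 * ((F.eri n m r s : ℚ) : ℂ))) • (singletExcitation s r : Op k) from
    (Finset.sum_congr rfl fun m _ => sum_comm3 _).trans (sum_comm3 _), Finset.sum_comm]
  refine Finset.sum_congr rfl fun s _ => Finset.sum_congr rfl fun r _ => ?_
  simp_rw [← Finset.sum_smul]
  congr 1
  push_cast
  rw [Finset.mul_sum]
  refine Finset.sum_congr rfl fun m _ => ?_
  rw [Finset.mul_sum]
  exact Finset.sum_congr rfl fun n _ => by ring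

/-- Regrouping of the exchange-like piece: `Σ_mn c_m c_n Σ_qr g_nqmr E_qr = Σ_xy (Σ_mn c_m c_n g_{nxmy}) E_xy`.
[folklore] -/
private theorem regroup_g2 (c : Fin k → ℚ) (F : Model k) :
    ∑ m : Fin k, ∑ n : Fin k, ((c m * c n : ℚ) : ℂ) •
        ∑ q : Fin k, ∑ r : Fin k, ((F.eri n q m r : ℚ) : ℂ) • (singletExcitation q r : Op k) =
      ∑ x : Fin k, ∑ y : Fin k,
        ((∑ m : Fin k, ∑ n : Fin k, c m * c n * F.eri n x m y : ℚ) : ℂ) • singletExcitation x y := by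
  simp_rw [Finset.smul_sum, smul_smul]
  rw [show (∑ m : Fin k, ∑ n : Fin k, ∑ q : Fin k, ∑ r : Fin k,
      (((c m * c n : ℚ) : ℂ) * ((F.eri n q m r : ℚ) : ℂ)) • (singletExcitation q r : Op k)) =
      ∑ q : Fin k, ∑ r : Fin k, ∑ m : Fin k, ∑ n : Fin k,
        (((c m * c n : ℚ) : ℂ) * ((F.eri n q m r : ℚ) : ℂ)) • (singletExcitation q r : Op k) from
    (Finset.sum_congr rfl fun m _ => sum_comm3 _).trans (sum_comm3 _)]
  refine Finset.sum_congr rfl fun q _ => Finset.sum_congr rfl fun r _ => ?_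
  simp_rw [← Finset.sum_smul]
  congr 1
  push_cast
  refine Finset.sum_congr rfl fun m _ => Finset.sum_congr rfl fun n _ => by ring

/-- Regrouping of the two-body piece: `Σ_mn c_m c_n Σ_qrs g_nqrs e_qmsr = Σ_pqrs B_pqrs e_pqrs`,
`B_pqrs = c_q Σ_n c_n g_{npsr}`. [folklore] -/
private theorem regroup_g3 (c : Fin k → ℚ) (F : Model k) :
    ∑ m : Fin k, ∑ n : Fin k, ((c m * c n : ℚ) : ℂ) •
        ∑ q : Fin k, ∑ r : Fin k, ∑ s : Fin k,
          ((F.eri n q r s : ℚ) : ℂ) • (twoElectronExcitation q m s r : Op k) =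
      particleTwoBodyOp c F := by
  rw [particleTwoBodyOp]
  simp_rw [Finset.smul_sum, smul_smul]
  -- (m, n, q, r, s) → (q, m, s, r, n)
  have step1 : ∀ m : Fin k, ∑ n : Fin k, ∑ q : Fin k, ∑ r : Fin k, ∑ s : Fin k,
      (((c m * c n : ℚ) : ℂ) * ((F.eri n q r s : ℚ) : ℂ)) • (twoElectronExcitation q m s r : Op k) =
      ∑ q : Fin k, ∑ s : Fin k, ∑ r : Fin k, ∑ n : Fin k,
        (((c m * c n : ℚ) : ℂ) * ((F.eri n q r s : ℚ) : ℂ)) • (twoElectronExcitation q m s r : Op k) := by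
    intro m
    rw [sum_comm3]
    refine Finset.sum_congr rfl fun q _ => ?_
    rw [sum_comm3, sum_comm3]
  simp_rw [step1]
  rw [Finset.sum_comm]
  refine Finset.sum_congr rfl fun q _ => Finset.sum_congr rfl fun m _ =>
    Finset.sum_congr rfl fun s _ => Finset.sum_congr rfl fun r _ => ?_
  rw [← Finset.sum_smul]
  congr 1
  rw [Model.particleTwoBodyRaw]
  push_cast
  rw [Finset.mul_sum]
  exact Finset.sum_congr rfl fun n _ => by ring

/-- **`Oᵖ = particleConst·1 + O₁ᵖ − O₂ᵖ`** — regrouping the normal-ordered expansion against `c_m c_n`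
(needs the FCIDUMP symmetries `g_pqrs = g_rspq`, `g_pqrs = g_pqsr`).
[cite: HelgakerJorgensenOlsen2000, eq. (10.8.20)] -/
theorem particleCommutatorOp_eq_parts (c : Fin k → ℚ) {F : Model k} (hF : F.IsSymmetric)
    (hg : ∀ p q r s, F.eri p q r s = F.eri r s p q) (hg2 : ∀ p q r s, F.eri p q r s = F.eri p q s r) :
    particleCommutatorOp c F = ((Model.particleConst c F : ℚ) : ℂ) • (1 : Op k) +
      particleOneBodyOp c F - particleTwoBodyOp c F := by
  rw [particleCommutatorOp_expand]
  simp_rw [sum_annihilation_mul_commutator_creation hF hg hg2, smul_sub, smul_add, smul_sub,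
    Finset.sum_sub_distrib, Finset.sum_add_distrib, Finset.sum_sub_distrib]
  have hconst : ∑ m : Fin k, ∑ n : Fin k, ((c m * c n : ℚ) : ℂ) • (((2 * F.h n m : ℚ) : ℂ) • (1 : Op k)) =
      ((Model.particleConst c F : ℚ) : ℂ) • (1 : Op k) := by
    simp_rw [smul_smul, ← Finset.sum_smul]
    congr 1
    rw [Model.particleConst]
    push_cast
    rw [Finset.mul_sum]
    refine Finset.sum_congr rfl fun m _ => ?_
    rw [Finset.mul_sum]
    exact Finset.sum_congr rfl fun n _ => by ring
  have hone : particleOneBodyOp c F =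
      -(∑ x : Fin k, ∑ y : Fin k, ((c y * Model.holeVecH c F x : ℚ) : ℂ) • (singletExcitation x y : Op k)) +
        ∑ x : Fin k, ∑ y : Fin k,
          ((2 * ∑ m : Fin k, ∑ n : Fin k, c m * c n * F.eri n m y x : ℚ) : ℂ) • singletExcitation x y -
        ∑ x : Fin k, ∑ y : Fin k,
          ((∑ m : Fin k, ∑ n : Fin k, c m * c n * F.eri n x m y : ℚ) : ℂ) • singletExcitation x y := by
    rw [particleOneBodyOp]
    simp_rw [Model.particleOneBodyRaw, Rat.cast_sub, Rat.cast_add, Rat.cast_neg, sub_smul, add_smul,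
      neg_smul, Finset.sum_sub_distrib, Finset.sum_add_distrib, Finset.sum_neg_distrib]
  rw [hconst, regroup_h, regroup_g1, regroup_g2, regroup_g3, hone]
  abel

end Summit.Ventures.CertifiedQuantumChemistry

end
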